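import Summits.Ventures.LatticeQCDFlow.Exactness.IMHColdStartPathAverage
import Summits.Ventures.LatticeQCDFlow.Scoring.ChainHoeffding
import HarnessLib

/-!
# Gaussian tails for the time averages of flow-MCMC with the exact Doeblin constant: a certified finite-`N`
# confidence statement from every start, the cold start included

HONEST FRAMING: exact (Metropolis-corrected) sampling algorithms for lattice gauge theory;
figures of merit are autocorrelation/cost numbers at stated couplings and volumes; no
continuum-physics claim.

Venture `LatticeQCDFlow` (cell pub-lqcd), topic `Exactness`; FANOUT row 30 (lean-1, GEN-33).  NEW WORK of the
cell, general state space.  GEN-32's error bars for the cold-started exact sampler were second-moment statements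
(Chebyshev tails; "NOT CLAIMED: confidence statements, tails sharper than Chebyshev").  The Scoring row's Hoeffding
inequality for Doeblin chains from ANY start (`Scoring/ChainHoeffding.chain_abs_tail_le_exp_of_doeblin`: martingale +
Poisson equation, Glynn–Ormoneit named only) needs one input: a minorisation `K(x, ·) ≥ ε·π`.  For flow-MCMC
`K = indepMH q w` with `w` normalised and maximal at `x₀` that input is EXACT with `ε = 1/w(x₀) = A`
(`IMHKernel.indepMH_apply_ge`), so:

* **`imh_chain_abs_tail_le_exp`** — for EVERY initial law `μ₀`, every bounded measurable `f` (`|f| ≤ C`,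
  `C' = C + |π f|`), every `N ≥ 1` and `s` with `N s ≥ 4C'w(x₀)`:
  `P_{μ₀}(|A_N − π f| ≥ s) ≤ 2·exp(−(N s − 4C'w(x₀))² / (8 N C'² w(x₀)²))` — Gaussian tails of rate `s²/(8C'²w²)` per
  update; one-sided **`imh_chain_tail_le_exp`** without the factor `2`;
* **`imh_chain_abs_tail_le_exp_mode`** — the cold start `μ₀ = δ_{x₀}` (the case a seat runs), and the CONFIDENCE form
  **`imh_chain_confidence_mode`**: `P_{x₀}(|A_N − π f| < s) ≥ 1 − 2·exp(−(N s − 4C'w)²/(8 N C'² w²))`.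

Reading (gauge files `Scaling/AutoregressiveGauge…Confidence`): with `w = 1/A`, `A = Z/(c^{#B}M^k)` resp.
`Z/∏_ℓ c_{#C_ℓ}`, `N` configurations of a cold-started exact gauge sampler locate `π f` within `±s` with certified
confidence `1 − 2exp(−(N s − 4C'/A)²A²/(8 N C'²))` — no stationarity, no variance estimate, no `τ_int`.  NOT CLAIMED:
sharpness of the constants (no Bernstein/variance-sensitive form; GEN-32's exact second moments are sharper at the
`1/√N` scale); unbounded observables.

No `sorry`, no new definitions, nothing cited as a fact; general measurable space with measurable singletons.
-/

noncomputable section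

namespace Summit.Ventures.LatticeQCDFlow.Exactness

open MeasureTheory ProbabilityTheory Function Finset
open scoped ENNReal
open Summit.Ventures.LatticeQCDFlow.Scoring

variable {Ω : Type*} [MeasurableSpace Ω] [MeasurableSingletonClass Ω]
variable {q : Measure Ω} [IsProbabilityMeasure q] {w : Ω → ℝ}

omit [MeasurableSingletonClass Ω] in
/-- **ONE-SIDED GAUSSIAN TAIL FROM EVERY START.**  `w` measurable (a `Fact`), positive, normalised, maximal at
`x₀`; `|f| ≤ C` measurable, `C' = C + |π f|`; `N ≥ 1`, `N s ≥ 4C'w(x₀)`.  Then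
`P_{μ₀}(A_N − π f ≥ s) ≤ exp(−(N s − 4C'w(x₀))² / (8 N C'² w(x₀)²))`. [ours] -/
theorem imh_chain_tail_le_exp [Fact (Measurable w)] (hw0 : ∀ y, 0 < w y) {x₀ : Ω} (hmax : ∀ y, w y ≤ w x₀)
    [IsProbabilityMeasure (q.withDensity fun y => ENNReal.ofReal (w y))] (μ₀ : Measure Ω) [IsProbabilityMeasure μ₀]
    {f : Ω → ℝ} (hf : Measurable f) {C : ℝ} (hC : ∀ x, |f x| ≤ C) {N : ℕ} (hN : N ≠ 0) {s : ℝ}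
    (hs : 4 * (C + |∫ z, f z ∂(q.withDensity fun y => ENNReal.ofReal (w y))|) * w x₀ ≤ N * s) :
    (Kernel.trajMeasure (X := fun _ : ℕ => Ω) μ₀
        (fun n : ℕ => (indepMH q w).comap (fun h : (i : ↥(Finset.Iic n)) → Ω => h ⟨n, Finset.mem_Iic.2 le_rfl⟩)
          (measurable_pi_apply _))).real
        {x | s ≤ (∑ i ∈ Finset.range N, f (x i)) / N - ∫ z, f z ∂(q.withDensity fun y => ENNReal.ofReal (w y))} ≤
      Real.exp (-(N * s - 4 * (C + |∫ z, f z ∂(q.withDensity fun y => ENNReal.ofReal (w y))|) * w x₀) ^ 2 /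
        (8 * N * (C + |∫ z, f z ∂(q.withDensity fun y => ENNReal.ofReal (w y))|) ^ 2 * w x₀ ^ 2)) := by
  have hw : Measurable w := Fact.out
  have hWpos : 0 < w x₀ := hw0 x₀
  have hπK : Kernel.Invariant (indepMH q w) (q.withDensity fun y => ENNReal.ofReal (w y)) :=
    indepMH_invariant (q := q) hw hw0
  have hmin : ∀ x {B : Set Ω}, MeasurableSet B →
      (ENNReal.ofReal (w x₀))⁻¹ * (q.withDensity fun y => ENNReal.ofReal (w y)) B ≤ indepMH q w x B :=
    fun x B hB => indepMH_apply_ge hw hw0 hmax x hB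
  have hε0 : 0 < (ENNReal.ofReal (w x₀))⁻¹ := ENNReal.inv_pos.2 ENNReal.ofReal_ne_top
  have htoReal : ((ENNReal.ofReal (w x₀))⁻¹).toReal = (w x₀)⁻¹ := by
    rw [ENNReal.toReal_inv, ENNReal.toReal_ofReal hWpos.le]
  have hs' : 4 * (C + |∫ z, f z ∂(q.withDensity fun y => ENNReal.ofReal (w y))|) /
      ((ENNReal.ofReal (w x₀))⁻¹).toReal ≤ N * s := by
    rw [htoReal, div_inv_eq_mul]; exact hs
  have h := chain_tail_le_exp_of_doeblin (μ₀ := μ₀) hπK hmin hε0 hf hC hN hs'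
  rw [htoReal, div_inv_eq_mul] at h
  have hrw : 8 * (N : ℝ) * (C + |∫ z, f z ∂(q.withDensity fun y => ENNReal.ofReal (w y))|) ^ 2 * w x₀ ^ 2 =
      8 * N * (C + |∫ z, f z ∂(q.withDensity fun y => ENNReal.ofReal (w y))|) ^ 2 / (w x₀)⁻¹ ^ 2 := by
    rw [div_eq_mul_inv, inv_pow, inv_inv]
  rw [hrw]
  exact h

omit [MeasurableSingletonClass Ω] in
/-- **TWO-SIDED GAUSSIAN TAIL FROM EVERY START**:
`P_{μ₀}(|A_N − π f| ≥ s) ≤ 2·exp(−(N s − 4C'w(x₀))² / (8 N C'² w(x₀)²))` for `N s ≥ 4C'w(x₀)`. [ours] -/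
theorem imh_chain_abs_tail_le_exp [Fact (Measurable w)] (hw0 : ∀ y, 0 < w y) {x₀ : Ω} (hmax : ∀ y, w y ≤ w x₀)
    [IsProbabilityMeasure (q.withDensity fun y => ENNReal.ofReal (w y))] (μ₀ : Measure Ω) [IsProbabilityMeasure μ₀]
    {f : Ω → ℝ} (hf : Measurable f) {C : ℝ} (hC : ∀ x, |f x| ≤ C) {N : ℕ} (hN : N ≠ 0) {s : ℝ}
    (hs : 4 * (C + |∫ z, f z ∂(q.withDensity fun y => ENNReal.ofReal (w y))|) * w x₀ ≤ N * s) :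
    (Kernel.trajMeasure (X := fun _ : ℕ => Ω) μ₀
        (fun n : ℕ => (indepMH q w).comap (fun h : (i : ↥(Finset.Iic n)) → Ω => h ⟨n, Finset.mem_Iic.2 le_rfl⟩)
          (measurable_pi_apply _))).real
        {x | s ≤ |(∑ i ∈ Finset.range N, f (x i)) / N - ∫ z, f z ∂(q.withDensity fun y => ENNReal.ofReal (w y))|} ≤
      2 * Real.exp (-(N * s - 4 * (C + |∫ z, f z ∂(q.withDensity fun y => ENNReal.ofReal (w y))|) * w x₀) ^ 2 /
        (8 * N * (C + |∫ z, f z ∂(q.withDensity fun y => ENNReal.ofReal (w y))|) ^ 2 * w x₀ ^ 2)) := by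
  have hw : Measurable w := Fact.out
  have hWpos : 0 < w x₀ := hw0 x₀
  have hπK : Kernel.Invariant (indepMH q w) (q.withDensity fun y => ENNReal.ofReal (w y)) :=
    indepMH_invariant (q := q) hw hw0
  have hmin : ∀ x {B : Set Ω}, MeasurableSet B →
      (ENNReal.ofReal (w x₀))⁻¹ * (q.withDensity fun y => ENNReal.ofReal (w y)) B ≤ indepMH q w x B :=
    fun x B hB => indepMH_apply_ge hw hw0 hmax x hB
  have hε0 : 0 < (ENNReal.ofReal (w x₀))⁻¹ := ENNReal.inv_pos.2 ENNReal.ofReal_ne_top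
  have htoReal : ((ENNReal.ofReal (w x₀))⁻¹).toReal = (w x₀)⁻¹ := by
    rw [ENNReal.toReal_inv, ENNReal.toReal_ofReal hWpos.le]
  have hs' : 4 * (C + |∫ z, f z ∂(q.withDensity fun y => ENNReal.ofReal (w y))|) /
      ((ENNReal.ofReal (w x₀))⁻¹).toReal ≤ N * s := by
    rw [htoReal, div_inv_eq_mul]; exact hs
  have h := chain_abs_tail_le_exp_of_doeblin (μ₀ := μ₀) hπK hmin hε0 hf hC hN hs'
  rw [htoReal, div_inv_eq_mul] at h
  have hrw : 8 * (N : ℝ) * (C + |∫ z, f z ∂(q.withDensity fun y => ENNReal.ofReal (w y))|) ^ 2 * w x₀ ^ 2 =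
      8 * N * (C + |∫ z, f z ∂(q.withDensity fun y => ENNReal.ofReal (w y))|) ^ 2 / (w x₀)⁻¹ ^ 2 := by
    rw [div_eq_mul_inv, inv_pow, inv_inv]
  rw [hrw]
  exact h

omit [MeasurableSingletonClass Ω] in
/-- **THE COLD START**: `P_{x₀}(|A_N − π f| ≥ s) ≤ 2·exp(−(N s − 4C'w(x₀))² / (8 N C'² w(x₀)²))`. [ours] -/
theorem imh_chain_abs_tail_le_exp_mode [Fact (Measurable w)] (hw0 : ∀ y, 0 < w y) {x₀ : Ω}
    (hmax : ∀ y, w y ≤ w x₀) [IsProbabilityMeasure (q.withDensity fun y => ENNReal.ofReal (w y))]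
    {f : Ω → ℝ} (hf : Measurable f) {C : ℝ} (hC : ∀ x, |f x| ≤ C) {N : ℕ} (hN : N ≠ 0) {s : ℝ}
    (hs : 4 * (C + |∫ z, f z ∂(q.withDensity fun y => ENNReal.ofReal (w y))|) * w x₀ ≤ N * s) :
    (Kernel.trajMeasure (X := fun _ : ℕ => Ω) (Measure.dirac x₀)
        (fun n : ℕ => (indepMH q w).comap (fun h : (i : ↥(Finset.Iic n)) → Ω => h ⟨n, Finset.mem_Iic.2 le_rfl⟩)
          (measurable_pi_apply _))).real
        {x | s ≤ |(∑ i ∈ Finset.range N, f (x i)) / N - ∫ z, f z ∂(q.withDensity fun y => ENNReal.ofReal (w y))|} ≤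
      2 * Real.exp (-(N * s - 4 * (C + |∫ z, f z ∂(q.withDensity fun y => ENNReal.ofReal (w y))|) * w x₀) ^ 2 /
        (8 * N * (C + |∫ z, f z ∂(q.withDensity fun y => ENNReal.ofReal (w y))|) ^ 2 * w x₀ ^ 2)) :=
  imh_chain_abs_tail_le_exp hw0 hmax (Measure.dirac x₀) hf hC hN hs

omit [MeasurableSingletonClass Ω] in
/-- **THE CONFIDENCE FORM FOR THE COLD-STARTED RUN**: `P_{x₀}(|A_N − π f| < s) ≥
1 − 2·exp(−(N s − 4C'w(x₀))² / (8 N C'² w(x₀)²))` — a certified finite-`N` confidence interval `A_N ± s` for `π f`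
with the sampler's own constant `w(x₀) = 1/A`. [ours] -/
theorem imh_chain_confidence_mode [Fact (Measurable w)] (hw0 : ∀ y, 0 < w y) {x₀ : Ω}
    (hmax : ∀ y, w y ≤ w x₀) [IsProbabilityMeasure (q.withDensity fun y => ENNReal.ofReal (w y))]
    {f : Ω → ℝ} (hf : Measurable f) {C : ℝ} (hC : ∀ x, |f x| ≤ C) {N : ℕ} (hN : N ≠ 0) {s : ℝ}
    (hs : 4 * (C + |∫ z, f z ∂(q.withDensity fun y => ENNReal.ofReal (w y))|) * w x₀ ≤ N * s) :
    1 - 2 * Real.exp (-(N * s - 4 * (C + |∫ z, f z ∂(q.withDensity fun y => ENNReal.ofReal (w y))|) * w x₀) ^ 2 /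
        (8 * N * (C + |∫ z, f z ∂(q.withDensity fun y => ENNReal.ofReal (w y))|) ^ 2 * w x₀ ^ 2)) ≤
      (Kernel.trajMeasure (X := fun _ : ℕ => Ω) (Measure.dirac x₀)
        (fun n : ℕ => (indepMH q w).comap (fun h : (i : ↥(Finset.Iic n)) → Ω => h ⟨n, Finset.mem_Iic.2 le_rfl⟩)
          (measurable_pi_apply _))).real
        {x | |(∑ i ∈ Finset.range N, f (x i)) / N - ∫ z, f z ∂(q.withDensity fun y => ENNReal.ofReal (w y))| < s} := by
  set P := Kernel.trajMeasure (X := fun _ : ℕ => Ω) (Measure.dirac x₀)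
      (fun n : ℕ => (indepMH q w).comap (fun h : (i : ↥(Finset.Iic n)) → Ω => h ⟨n, Finset.mem_Iic.2 le_rfl⟩)
        (measurable_pi_apply _)) with hP
  have htail := imh_chain_abs_tail_le_exp_mode (q := q) hw0 hmax hf hC hN hs (x₀ := x₀)
  rw [← hP] at htail
  have hAm : Measurable fun x : ℕ → Ω =>
      |(∑ i ∈ Finset.range N, f (x i)) / N - ∫ z, f z ∂(q.withDensity fun y => ENNReal.ofReal (w y))| :=
    (((Finset.measurable_sum _ fun i _ => hf.comp (measurable_pi_apply i)).div_const _).sub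
      measurable_const).abs
  have hE : MeasurableSet {x : ℕ → Ω |
      s ≤ |(∑ i ∈ Finset.range N, f (x i)) / N - ∫ z, f z ∂(q.withDensity fun y => ENNReal.ofReal (w y))|} :=
    measurableSet_le measurable_const hAm
  have hcompl : {x : ℕ → Ω |
      |(∑ i ∈ Finset.range N, f (x i)) / N - ∫ z, f z ∂(q.withDensity fun y => ENNReal.ofReal (w y))| < s} =
      {x : ℕ → Ω |
        s ≤ |(∑ i ∈ Finset.range N, f (x i)) / N - ∫ z, f z ∂(q.withDensity fun y => ENNReal.ofReal (w y))|}ᶜ := by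
    ext x
    simp only [Set.mem_setOf_eq, Set.mem_compl_iff, not_le]
  rw [hcompl, measureReal_compl hE, probReal_univ]
  linarith

end Summit.Ventures.LatticeQCDFlow.Exactness
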